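import Summits.BirchSwinnertonDyer.BirchSwinnertonDyer.Theorems.CyclotomicUntwistNineGoodModelTransport
import Summits.BirchSwinnertonDyer.BirchSwinnertonDyer.Theorems.CyclotomicUntwistKatzFrobeniusModVarpi
import Summits.BirchSwinnertonDyer.BirchSwinnertonDyer.Theorems.CyclotomicUntwistNineHondaCongruence
import Literature.NumberTheory.EllipticCurves.FormalGroupDictionaryProofs
import HarnessLib

/-!
# Bounded-denominator calculus under an integral substitution `Γ ∈ z𝓞⟦z⟧` (`𝓞 = 𝓞_{ℚ₃(ζ₉)}`): substitution preserves
# bounded denominators, `Γ^{3ᵏ} ≡ Γ(z^{3ᵏ}) (mod ϖ)`, power maps commute with `∘Γ` modulo bounded denominators for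
# log-type series; the Néron representatives of a good model are log-type

Cell `pub/bsd-wall` (D-0145 line `route-BirchSwinnertonDyer-CyclotomicUntwist`), width seat `bsd-line-cycu-p4` (gen 8), lane
«MODEL TRANSPORT ALONG THE 𝓞-CHANGE» (part 2 of 3: part 1 = `CyclotomicUntwistNineGoodModelTransport`, part 3 =
`CyclotomicUntwistDescendedFrobeniusOneModel`). THEOREMS ONLY (no definition, no instance, no named fact, no `sorry`);
helper `--supports` K1 = stmt-BirchSwinnertonDyer-21580 (serves K2 = 21581 and the print child C2 = 27549, input
`WeierstrassCurve.isDescendedFrobeniusMatrix_exists`). BSD is not proved by this file and no crux / stub is.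

* §1 `hbd_subst` — `3ᵈ·f ∈ 𝓞⟦z⟧ ⇒ 3ᵈ·(f∘Γ) ∈ 𝓞⟦z⟧` (`[zⁿ]f(Γ) = Σ_{m≤n} f_m[zⁿ]Γᵐ`);
* §2 `C_dvd_pow_three_pow_sub_expand` — `Γ^{3ᵏ} ≡ Γ(z^{3ᵏ}) (mod ϖ𝓞⟦z⟧)` (Frobenius of `𝓞/ϖ = 𝔽₃`, iterating cycu-p3's
  `KatzFrobenius.dvd_mvCoeff_pow_three_sub_expand`); `isIntegral_three_pow_mul_coeff_subst_sub_subst` (cycu-p3's Key Lemma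
  modulo `ϖ` read for one variable); **`hbd_expand_subst_sub_expand_subst`** — for `f` with `3ᵈ·n·[zⁿ]f ∈ 𝓞`:
  `(f(z^{3ᵏ}))∘Γ − (f∘Γ)(z^{3ᵏ}) = f(Γ^{3ᵏ}) − f(Γ(z^{3ᵏ}))` has bounded denominators [Ka81, Key Lemma 5.1.3, Thm 5.1.4];
* §3–§4 `logType_formalLog`, `logType_formalEtaIntegral` (`n·[zⁿ]∫η = [z^{n+1}](z²x)(ω/dz) ∈ 𝓞`), `logType_C_mul`,
  `logType_add`, **`logType_classOmega`**, **`logType_classEta`** — the Néron representatives of a good model are log-type.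

References: N. M. Katz, LNM 868 (1981) §5.1 Lemma 5.1.2, Key Lemma 5.1.3, Thm 5.1.4 [Katz1981CrystallineDieudonne];
P. Berthelot, A. Ogus, Invent. Math. 72 (1983) (2.4) (proof) [BerthelotOgus1983]; Silverman *AEC* IV.1, IV.4–5 [SilvermanAEC2009].
-/

set_option autoImplicit false
-- single-conjunct summit: `Summit.BirchSwinnertonDyer.BirchSwinnertonDyer.…` repeats the name by design
set_option linter.dupNamespace false

noncomputable section

open scoped Classical
open PowerSeries WeierstrassCurve Literature.NumberTheory.EllipticCurves.DescendedFrobenius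
  Summit.BirchSwinnertonDyer.BirchSwinnertonDyer.Theorems
  Summit.BirchSwinnertonDyer.BirchSwinnertonDyer.Theorems.DescendedFrobeniusTransfer
  Summit.BirchSwinnertonDyer.BirchSwinnertonDyer.Theorems.NineGoodModelTransport

namespace Summit.BirchSwinnertonDyer.BirchSwinnertonDyer.Theorems.NineGoodModelTransportCalculus

/-! ### §1 Substituting an `𝓞`-series preserves bounded denominators -/

/-- **Substitution of an integral series preserves bounded denominators**: if `3ᵈ·f ∈ 𝓞⟦z⟧` and
`Γ ∈ z𝓞⟦z⟧`, then `3ᵈ·f(Γ) ∈ 𝓞⟦z⟧` (`[zⁿ]f(Γ) = Σ_{m ≤ n} f_m [zⁿ]Γᵐ`).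
[cite: Katz1981CrystallineDieudonne, §5.1 (p. 193)] -/
theorem hbd_subst {f : KNine⟦X⟧} (hf : HasBoundedDenominators f) {G : ONine⟦X⟧}
    (hG : constantCoeff G = 0) :
    HasBoundedDenominators (f.subst (G.map (algebraMap ONine KNine))) := by
  obtain ⟨d, hd⟩ := hf
  have hG' : constantCoeff (G.map (algebraMap ONine KNine)) = 0 := by
    rw [← coeff_zero_eq_constantCoeff, coeff_map, coeff_zero_eq_constantCoeff, hG, map_zero]
  refine ⟨d, fun n => ?_⟩
  rw [coeff_subst_eq_sum_range' f hG' n, Finset.mul_sum]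
  refine IsIntegral.sum _ fun m _ => ?_
  rw [← mul_assoc, ← map_pow]
  exact (hd m).mul (isIntegral_coeff_map _ _)

/-! ### §2 Frobenius congruence `Γ^{3ᵏ} ≡ Γ(z^{3ᵏ}) (mod ϖ)` and the commutation of power maps with substitution -/

/-- `G(z^{3^{k+1}}) = (G(z^{3ᵏ}))(z³)` (iterated power maps). [folklore] -/
theorem expand_three_pow_succ {R : Type*} [CommRing R] (G : R⟦X⟧) (k : ℕ) :
    expand (3 ^ (k + 1)) (pow_ne_zero _ (by norm_num)) G =
      expand 3 (by norm_num) (expand (3 ^ k) (pow_ne_zero _ (by norm_num)) G) := by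
  rw [expand_apply, expand_apply, expand_apply,
    subst_comp_subst_apply (HasSubst.X_pow (pow_ne_zero _ (by norm_num))) (HasSubst.X_pow (by norm_num)),
    subst_pow (HasSubst.X_pow (by norm_num)), subst_X (HasSubst.X_pow (by norm_num)), ← pow_mul,
    ← pow_succ']

/-- `Γ^{3ᵏ} ≡ Γ(z^{3ᵏ}) (mod ϖ𝓞⟦z⟧)` for every `Γ ∈ 𝓞⟦z⟧`: the `3ᵏ`-th power map of `𝓞/ϖ = 𝔽₃`-series is
`z ↦ z^{3ᵏ}` on exponents. [cite: BerthelotOgus1983, Thm. 2.4 (proof)] -/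
theorem C_dvd_pow_three_pow_sub_expand {ϖ : ONine} (ρ : ONine →+* ZMod 3)
    (hker : ∀ x : ONine, ρ x = 0 → ϖ ∣ x) (G : ONine⟦X⟧) (k : ℕ) :
    PowerSeries.C ϖ ∣ G ^ 3 ^ k - expand (3 ^ k) (pow_ne_zero k (by norm_num)) G := by
  induction k with
  | zero => simp
  | succ k ih =>
    set A := expand (3 ^ k) (pow_ne_zero k (by norm_num)) G with hA
    have h3 : PowerSeries.C ϖ ∣ A ^ 3 - expand 3 (by norm_num) A := by
      choose c hc using KatzFrobenius.dvd_mvCoeff_pow_three_sub_expand (σ := Unit) ρ hker A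
      refine ⟨PowerSeries.mk fun n => c (Finsupp.single () n), PowerSeries.ext fun n => ?_⟩
      rw [coeff_C_mul, coeff_mk]
      exact hc (Finsupp.single () n)
    have e1 : G ^ 3 ^ (k + 1) - expand (3 ^ (k + 1)) (pow_ne_zero (k + 1) (by norm_num)) G =
        ((G ^ 3 ^ k) ^ 3 - A ^ 3) + (A ^ 3 - expand 3 (by norm_num) A) := by
      rw [expand_three_pow_succ, ← hA, pow_succ, pow_mul]; ring
    rw [e1]
    exact dvd_add (ih.trans (sub_dvd_pow_sub_pow _ _ 3)) h3

/-- Katz's Key Lemma modulo `ϖ` (cycu-p3 g8, `KatzFrobenius.isIntegral_three_pow_mul_mvCoeff_subst_sub_subst`)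
read for ONE-variable series. [cite: Katz1981CrystallineDieudonne, §5 Key Lemma 5.1.3] -/
theorem isIntegral_three_pow_mul_coeff_subst_sub_subst {ϖ θ θ' : ONine}
    (h3 : (3 : ONine) = ϖ ^ 6 * θ) (hθ : θ * θ' = 1) {f : KNine⟦X⟧} {d : ℕ}
    (hf : ∀ n : ℕ, IsIntegral ℤ_[3] ((3 : KNine) ^ d * ((n : KNine) * coeff n f)))
    {U V : ONine⟦X⟧} (hU0 : constantCoeff U = 0) (hV0 : constantCoeff V = 0)
    (hUV : PowerSeries.C ϖ ∣ U - V) (n : ℕ) :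
    IsIntegral ℤ_[3] ((3 : KNine) ^ (d + 1) * coeff n
      (f.subst (U.map (algebraMap ONine KNine)) - f.subst (V.map (algebraMap ONine KNine)))) :=
  KatzFrobenius.isIntegral_three_pow_mul_mvCoeff_subst_sub_subst (σ := Unit) h3 hθ hf hU0 hV0 hUV
    (Finsupp.single () n)

/-- `(f ∘ Γ)(z^q) = f(Γ(z^q))`. [folklore] -/
theorem expand_subst_eq_subst_expand {R : Type*} [CommRing R] {Γ : R⟦X⟧} (hΓ : constantCoeff Γ = 0)
    (q : ℕ) (hq : q ≠ 0) (f : R⟦X⟧) :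
    expand q hq (f.subst Γ) = f.subst (expand q hq Γ) := by
  rw [expand_apply, expand_apply,
    subst_comp_subst_apply (HasSubst.of_constantCoeff_zero' hΓ) (HasSubst.X_pow hq)]

/-- **Power maps commute with an integral substitution modulo bounded denominators.** For `f ∈ ℚ₃(ζ₉)⟦z⟧`
with `3ᵈ·n·[zⁿ]f ∈ 𝓞` (log-type denominators) and `Γ ∈ z𝓞⟦z⟧`:
`(f(z^{3ᵏ}))∘Γ − (f∘Γ)(z^{3ᵏ}) = f(Γ^{3ᵏ}) − f(Γ(z^{3ᵏ}))` has bounded denominators (`Γ^{3ᵏ} ≡ Γ(z^{3ᵏ}) (mod ϖ)`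
and Katz's Key Lemma modulo `ϖ`). [cite: Katz1981CrystallineDieudonne, §5 Key Lemma 5.1.3 and Thm 5.1.4] -/
theorem hbd_expand_subst_sub_expand_subst {f : KNine⟦X⟧} {d : ℕ}
    (hf : ∀ n : ℕ, IsIntegral ℤ_[3] ((3 : KNine) ^ d * ((n : KNine) * coeff n f)))
    {G : ONine⟦X⟧} (hG : constantCoeff G = 0) (k : ℕ) :
    HasBoundedDenominators
      ((expand (3 ^ k) (pow_ne_zero k (by norm_num)) f).subst (G.map (algebraMap ONine KNine)) -
        expand (3 ^ k) (pow_ne_zero k (by norm_num)) (f.subst (G.map (algebraMap ONine KNine)))) := by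
  set ι := algebraMap ONine KNine with hι
  obtain ⟨ϖ, θ, θ', h3, hθ, hker, -⟩ := KatzFrobenius.exists_uniformizer
  obtain ⟨ρ⟩ := NineIntegers.nonempty_residueMap
  have hUV := C_dvd_pow_three_pow_sub_expand ρ (hker ρ) G k
  have hG' : constantCoeff (G.map ι) = 0 := by
    rw [← coeff_zero_eq_constantCoeff, coeff_map, coeff_zero_eq_constantCoeff, hG, map_zero]
  have hU0 : constantCoeff (G ^ 3 ^ k) = 0 := by
    rw [map_pow, hG, zero_pow (pow_ne_zero k (by norm_num))]
  have hV0 : constantCoeff (expand (3 ^ k) (pow_ne_zero k (by norm_num)) G) = 0 := by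
    rw [constantCoeff_expand, hG]
  have e : (expand (3 ^ k) (pow_ne_zero k (by norm_num)) f).subst (G.map ι) -
        expand (3 ^ k) (pow_ne_zero k (by norm_num)) (f.subst (G.map ι)) =
      f.subst ((G ^ 3 ^ k).map ι) - f.subst ((expand (3 ^ k) (pow_ne_zero k (by norm_num)) G).map ι) := by
    rw [KatzFrobenius.expand_subst_eq hG', expand_subst_eq_subst_expand hG', map_pow, map_expand]
  rw [e]
  exact ⟨d + 1, isIntegral_three_pow_mul_coeff_subst_sub_subst h3 hθ hf hU0 hV0 hUV⟩

/-! ### §3 The two Néron representatives of a good model have log-type denominators -/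

section LogType

variable {W : WeierstrassCurve ℚ} (𝓜 : W.NineGoodModel)

/-- `n·[zⁿ] log_𝓔 ∈ 𝓞` for the good model (`NineHonda.natCast_mul_coeff_formalLog_mem`), in the `3ᵈ`-form with
`d = 0`. [cite: SilvermanAEC2009, IV.4–IV.5] -/
theorem logType_formalLog (n : ℕ) :
    _root_.IsIntegral ℤ_[3] ((3 : KNine) ^ 0 * ((n : KNine) * coeff n 𝓜.curve.formalLog)) := by
  rw [pow_zero, one_mul]
  exact NineHonda.natCast_mul_coeff_formalLog_mem 𝓜.E n

/-- The series `P = (z²x)·(ω/dz)` of the good model has coefficients in `𝓞`. [cite: SilvermanAEC2009, IV.1] -/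
theorem coeff_formalXMulSq_mul_formalOmega_mem (n : ℕ) :
    coeff n (𝓜.curve.formalXMulSq * 𝓜.curve.formalOmega) ∈ ONine := by
  have e : 𝓜.curve.formalXMulSq * 𝓜.curve.formalOmega =
      (𝓜.E.formalXMulSq * 𝓜.E.formalInvDiff).map (algebraMap ONine KNine) := by
    rw [map_mul, map_formalXMulSq, map_formalInvDiff, formalInvDiff_eq_formalOmega]; rfl
  rw [e, coeff_map]
  exact (coeff n (𝓜.E.formalXMulSq * 𝓜.E.formalInvDiff)).2

/-- `n·[zⁿ] ∫(xω − dz/z²) ∈ 𝓞` for the good model: `n·[zⁿ]∫η = [z^{n+1}]P`, `P = (z²x)(ω/dz) ∈ 𝓞⟦z⟧`.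
[cite: Katz1981CrystallineDieudonne, §5 Lemma 5.1.2] -/
theorem logType_formalEtaIntegral (n : ℕ) :
    _root_.IsIntegral ℤ_[3] ((3 : KNine) ^ 0 * ((n : KNine) * coeff n 𝓜.curve.formalEtaIntegral)) := by
  rw [pow_zero, one_mul]
  rcases n with _ | m
  · simp only [Nat.cast_zero, zero_mul]; exact isIntegral_zero
  · rw [coeff_succ_formalEtaIntegral, ← mul_assoc, map_div₀, map_one,
      show ((m + 1 : ℚ)) = ((m + 1 : ℕ) : ℚ) by push_cast; ring, map_natCast,
      mul_one_div_cancel (Nat.cast_ne_zero.mpr (Nat.succ_ne_zero m)), one_mul]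
    exact coeff_formalXMulSq_mul_formalOmega_mem 𝓜 (m + 2)

end LogType

/-! ### §4 Log-type denominators of the Néron classes; power maps through `θ` -/

section Classes

variable {W : WeierstrassCurve ℚ} (𝓜 : W.NineGoodModel)

/-- Scaling a log-type series by a constant of `K` keeps it log-type (with a larger `3`-power). [folklore] -/
theorem logType_C_mul (c : KNine) {f : KNine⟦X⟧} {d : ℕ}
    (hf : ∀ n : ℕ, _root_.IsIntegral ℤ_[3] ((3 : KNine) ^ d * ((n : KNine) * coeff n f))) :
    ∃ d' : ℕ, ∀ n : ℕ, _root_.IsIntegral ℤ_[3] ((3 : KNine) ^ d' * ((n : KNine) * coeff n (PowerSeries.C c * f))) := by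
  obtain ⟨k, hk⟩ := exists_three_pow_mul_isIntegral c
  refine ⟨k + d, fun n => ?_⟩
  rw [coeff_C_mul, show (3 : KNine) ^ (k + d) * ((n : KNine) * (c * coeff n f)) =
    ((3 : KNine) ^ k * c) * ((3 : KNine) ^ d * ((n : KNine) * coeff n f)) by ring]
  exact (hk).mul (hf n)

/-- The sum of two log-type series is log-type. [folklore] -/
theorem logType_add {f g : KNine⟦X⟧} {d d' : ℕ}
    (hf : ∀ n : ℕ, _root_.IsIntegral ℤ_[3] ((3 : KNine) ^ d * ((n : KNine) * coeff n f)))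
    (hg : ∀ n : ℕ, _root_.IsIntegral ℤ_[3] ((3 : KNine) ^ d' * ((n : KNine) * coeff n g))) (n : ℕ) :
    _root_.IsIntegral ℤ_[3] ((3 : KNine) ^ (d + d') * ((n : KNine) * coeff n (f + g))) := by
  rw [map_add, show (3 : KNine) ^ (d + d') * ((n : KNine) * (coeff n f + coeff n g)) =
    (3 : KNine) ^ d' * ((3 : KNine) ^ d * ((n : KNine) * coeff n f)) +
      (3 : KNine) ^ d * ((3 : KNine) ^ d' * ((n : KNine) * coeff n g)) by ring]
  exact ((KatzFrobenius.isIntegral_three_pow d').mul (hf n)).add ((KatzFrobenius.isIntegral_three_pow d).mul (hg n))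

/-- **`classOmega` has log-type denominators**: `3ᵈ·n·[zⁿ]classOmega ∈ 𝓞` for some `d` (`= u⁻¹·log_𝓔`).
[cite: Katz1981CrystallineDieudonne, §5 Lemma 5.1.2] -/
theorem logType_classOmega :
    ∃ d : ℕ, ∀ n : ℕ, _root_.IsIntegral ℤ_[3] ((3 : KNine) ^ d * ((n : KNine) * coeff n 𝓜.classOmega)) := by
  rw [NineGoodModel.classOmega, smul_eq_C_mul]
  exact logType_C_mul _ (logType_formalLog 𝓜)

/-- **`classEta` has log-type denominators** (`= u·∫η_𝓔 + ru⁻¹·log_𝓔`). [cite: Katz1981CrystallineDieudonne, §5 Lemma 5.1.2] -/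
theorem logType_classEta :
    ∃ d : ℕ, ∀ n : ℕ, _root_.IsIntegral ℤ_[3] ((3 : KNine) ^ d * ((n : KNine) * coeff n 𝓜.classEta)) := by
  rw [NineGoodModel.classEta, smul_eq_C_mul, smul_eq_C_mul]
  obtain ⟨d₁, h₁⟩ := logType_C_mul (𝓜.C.u : KNine) (logType_formalEtaIntegral 𝓜)
  obtain ⟨d₂, h₂⟩ := logType_C_mul (𝓜.C.r * ((𝓜.C.u⁻¹ : KNineˣ) : KNine)) (logType_formalLog 𝓜)
  exact ⟨d₁ + d₂, logType_add h₁ h₂⟩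

end Classes

end Summit.BirchSwinnertonDyer.BirchSwinnertonDyer.Theorems.NineGoodModelTransportCalculus

end
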